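import Literature.Probability.RandomPlanarGeometry.HexSAWSurfaceWallRenewalKendallUniform
import HarnessLib

/-!
# What the uniform Kendall rate buys: a MODULUS of continuity for `1/m(y)` and the ratio test for `β(y)²` with an explicit geometric rate

Lane pcv-sawmu, a-idea-1 gen 29, car 52 «KENDALL-MODULUS». CLASS D on `HexSAWSurfaceWallRenewalKendallUniform`
(car 51: `exists_uniform_geometric_rate_pwbAmp`, the Kendall rate `|u_s(y) − 1/m(y)| ≤ K ρ^{-s}` with ONE `(ρ, K)`
for all `y ≥ y₀ > μ⁴`; `div_sq_wallRate_le_pwbLaw_one_of_le`), hence on cars 48, 47, 39 and the tree's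
`HexSAWSurfaceWallRenewal` (car 33) and `HexSAWSurfaceWallRateSqrtMonotone`.

Here `u_s(y) = pwbAmp y s = PWB_{2s}(y)/β(y)^{2s}` (adsorbed positive wall bridges of the honeycomb half-plane,
`β = wallRate`), `m(y) = pwbMean y` the mean of the irreducible-bridge law, `y > μ⁴`.

**A. Two fugacities, one length** (`0 < y ≤ y'`; elementary, no renewal input): `PWB_n(y) ≤ PWB_n(y') ≤ (y'/y)ⁿ PWB_n(y)`
(`visits ≤ n`), `β(y) ≤ β(y') ≤ √(y'/y) β(y)` (tree) ⇒ `(y/y')^s u_s(y) ≤ u_s(y') ≤ (y'/y)^{2s} u_s(y)` and, with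
`0 ≤ u ≤ 1`, ★ `abs_pwbAmp_sub_pwbAmp_le : |u_s(y') − u_s(y)| ≤ (y'/y)^{2s} − 1`.

**B. A modulus of continuity for the renewal amplitude `1/m(y)`** — the statement for which the RATE is needed
(continuity of `m` alone is soft; a modulus is not): for `y₀ ≤ y ≤ y'` and EVERY `s`,
★ `abs_inv_pwbMean_sub_le_two_term : |1/m(y) − 1/m(y')| ≤ 2K ρ^{-s} + ((y'/y)^{2s} − 1)`
(triangle inequality through `u_s(y)`, `u_s(y')`), and, choosing `s = ⌈log(1/ε)/log ρ⌉` with `ε = y'/y − 1`,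
★★ `abs_inv_pwbMean_sub_le_logLipschitz : |1/m(y) − 1/m(y')| ≤ ε (2K + 4 + 4 log(1/ε)/log ρ)` whenever
`0 < ε ≤ 1` and `4ε (log(1/ε)/log ρ + 1) ≤ 1`: the renewal amplitude is LOCALLY LOG-LIPSCHITZ in the fugacity on
`[y₀, ∞)`, with constants explicit in Kendall's `(ρ, K)` of car 51 (`exists_two_term_modulus_inv_pwbMean`,
`exists_logLipschitz_inv_pwbMean` package the existential forms). Honest note: `m(y)` is expected to be
real-analytic on `(μ⁴, ∞)` (the adsorbed rate solves an analytic implicit equation), which would give a Lipschitz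
modulus; that is not in the tree, and the log-Lipschitz modulus here is what the certified finite-data rate delivers.

**C. The ratio test with a rate, uniformly in `y`**: the tree's rate-free `tendsto_PWB_ratio`
(`PWB_{2s+2}(y)/PWB_{2s}(y) → β(y)²`) becomes ★★ `exists_uniform_geometric_rate_PWB_ratio :
∃ ρ > 1, ∃ K, ∀ y ≥ y₀, ∀ s, |PWB_{2s+2}(y)/PWB_{2s}(y) − β(y)²| ≤ K β(y)² ρ^{-s}` — the growth constant of adsorbed
wall bridges is read off two consecutive partition functions with an explicitly exponentially small relative
error, uniformly on `[y₀, ∞)` (small `s` are absorbed using `u_s(y) ≥ u_1(y)^s ≥ (y₀/β(y₀)²)^s`, large `s` using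
`u_s ≥ 1/(2M₀)` with the uniform mean bound `m(y) ≤ M₀ = 1 + μ⁴θ₀/(1−θ₀)²`, `pwbMean_le_of_le`).

Primary sources: [cite: MadrasSlade1993, §4.2 Theorem 4.2.5 (p. 95); §1.2 (1.2.4)–(1.2.10) (pp. 9–10): ratio
and root tests for connective constants]; [cite: Bednorz2013, §2, Corollary 2.5 (p. 5)] (explicit Kendall
constants); [cite: BeatonBousquetMelouDeGierDuminilCopinGuttmann2014, §3.1, Proposition 5 (arXiv v5 p. 9)]
(`β` non-decreasing, `β/√y` non-increasing, continuity); [cite: Feller1968, XIII.10].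
-/

noncomputable section

open Finset Filter
open _root_.Topology

namespace Literature.Probability.RandomPlanarGeometry.SAW.HexBW.Wall

variable {y y' y₀ : ℝ}

/-- [folklore] `μ⁴ < y` forces `0 < y` (`1 < μ`). [cite: MadrasSlade1993, §1.2 (1.2.16) (p. 11)] -/
private theorem pos_of_mu_four_lt_km (hy : hexConnectiveConstant ^ 4 < y) : 0 < y := by
  have h1 : (1 : ℝ) ≤ hexConnectiveConstant ^ 4 := one_le_pow₀ HV.one_lt_hexConnectiveConstant.le
  linarith

/-- [folklore] `0 < θ(y) = μ²/√y < 1` for `μ⁴ < y`. [cite: MadrasSlade1993, §4.2, remark before (4.2.21) (p. 94)] -/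
private theorem theta_pos_lt_one_km (hy : hexConnectiveConstant ^ 4 < y) :
    0 < hexConnectiveConstant ^ 2 / Real.sqrt y ∧ hexConnectiveConstant ^ 2 / Real.sqrt y < 1 := by
  have hy0 := pos_of_mu_four_lt_km hy
  have hμ := hexConnectiveConstant_pos
  refine ⟨div_pos (pow_pos hμ 2) (Real.sqrt_pos.2 hy0), ?_⟩
  rw [div_lt_one (Real.sqrt_pos.2 hy0), Real.lt_sqrt (by positivity)]
  calc (hexConnectiveConstant ^ 2) ^ 2 = hexConnectiveConstant ^ 4 := by ring
    _ < y := hy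

/-! ### A. The partition functions and amplitudes at two fugacities -/

/-- `PWB_n` is non-decreasing in the fugacity (non-negative coefficients). [cite: BeatonBousquetMelouDeGierDuminilCopinGuttmann2014, §3.1 (wall-visit weights)] -/
theorem PWB_mono_right (n : ℕ) (hy : 0 ≤ y) (h : y ≤ y') : PWB n y ≤ PWB n y' :=
  Finset.sum_le_sum fun _ _ => pow_le_pow_left₀ hy h _

/-- `PWB_n(y') ≤ (y'/y)ⁿ PWB_n(y)` for `0 < y ≤ y'` (a bridge of length `n` has at most `n` surface visits).
[cite: BeatonBousquetMelouDeGierDuminilCopinGuttmann2014, §3.1 (wall-visit weights)] -/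
theorem PWB_le_div_pow_mul_PWB (n : ℕ) (hy : 0 < y) (h : y ≤ y') : PWB n y' ≤ (y' / y) ^ n * PWB n y := by
  have hr : 1 ≤ y' / y := (one_le_div hy).2 h
  unfold PWB
  rw [Finset.mul_sum]
  refine Finset.sum_le_sum fun ω _ => ?_
  have hv : visits n ω ≤ n := visits_le n ω
  calc y' ^ visits n ω = (y' / y) ^ visits n ω * y ^ visits n ω := by
        rw [← mul_pow, div_mul_cancel₀ _ hy.ne']
    _ ≤ (y' / y) ^ n * y ^ visits n ω :=
        mul_le_mul_of_nonneg_right (pow_le_pow_right₀ hr hv) (pow_nonneg hy.le _)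

/-- Upper comparison of amplitudes: `u_s(y') ≤ (y'/y)^{2s} u_s(y)` for `0 < y ≤ y'` (`β` non-decreasing).
[cite: BeatonBousquetMelouDeGierDuminilCopinGuttmann2014, §3.1, Proposition 5 (arXiv v5 p. 9)] -/
theorem pwbAmp_le_div_pow_mul_pwbAmp (hy : 0 < y) (h : y ≤ y') (s : ℕ) :
    pwbAmp y' s ≤ (y' / y) ^ (2 * s) * pwbAmp y s := by
  have hβ := wallRate_pos y
  have hββ' : wallRate y ^ (2 * s) ≤ wallRate y' ^ (2 * s) :=
    pow_le_pow_left₀ hβ.le (wallRate_mono hy h) _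
  unfold pwbAmp
  rw [← mul_div_assoc]
  calc PWB (2 * s) y' / wallRate y' ^ (2 * s) ≤ PWB (2 * s) y' / wallRate y ^ (2 * s) :=
        div_le_div_of_nonneg_left (PWB_nonneg _ (hy.le.trans h)) (pow_pos hβ _) hββ'
    _ ≤ (y' / y) ^ (2 * s) * PWB (2 * s) y / wallRate y ^ (2 * s) :=
        div_le_div_of_nonneg_right (PWB_le_div_pow_mul_PWB _ hy h) (pow_pos hβ _).le

/-- Lower comparison of amplitudes: `(y/y')^s u_s(y) ≤ u_s(y')` for `0 < y ≤ y'` (`β(y') ≤ √(y'/y) β(y)`).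
[cite: BeatonBousquetMelouDeGierDuminilCopinGuttmann2014, §3.1, Proposition 5 (arXiv v5 p. 9)] -/
theorem div_pow_mul_pwbAmp_le_pwbAmp (hy : 0 < y) (h : y ≤ y') (s : ℕ) :
    (y / y') ^ s * pwbAmp y s ≤ pwbAmp y' s := by
  have hy' : 0 < y' := hy.trans_le h
  have hβ := wallRate_pos y
  have hβ' := wallRate_pos y'
  have h1 : wallRate y' ^ (2 * s) ≤ (y' / y) ^ s * wallRate y ^ (2 * s) := by
    have h2 : wallRate y' ^ 2 ≤ y' / y * wallRate y ^ 2 := by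
      calc wallRate y' ^ 2 ≤ (Real.sqrt (y' / y) * wallRate y) ^ 2 :=
            pow_le_pow_left₀ hβ'.le (wallRate_le_sqrt_mul hy h) 2
        _ = y' / y * wallRate y ^ 2 := by rw [mul_pow, Real.sq_sqrt (div_nonneg hy'.le hy.le)]
    calc wallRate y' ^ (2 * s) = (wallRate y' ^ 2) ^ s := by rw [pow_mul]
      _ ≤ (y' / y * wallRate y ^ 2) ^ s := pow_le_pow_left₀ (sq_nonneg _) h2 s
      _ = (y' / y) ^ s * wallRate y ^ (2 * s) := by rw [mul_pow, ← pow_mul]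
  have hP : PWB (2 * s) y ≤ PWB (2 * s) y' := PWB_mono_right _ hy.le h
  unfold pwbAmp
  calc (y / y') ^ s * (PWB (2 * s) y / wallRate y ^ (2 * s))
      = PWB (2 * s) y / ((y' / y) ^ s * wallRate y ^ (2 * s)) := by
        rw [div_pow, div_pow]
        field_simp
    _ ≤ PWB (2 * s) y / wallRate y' ^ (2 * s) :=
        div_le_div_of_nonneg_left (PWB_nonneg _ hy.le) (pow_pos hβ' _) h1
    _ ≤ PWB (2 * s) y' / wallRate y' ^ (2 * s) := div_le_div_of_nonneg_right hP (pow_pos hβ' _).le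

/-- **Amplitudes at two fugacities**: `|u_s(y') − u_s(y)| ≤ (y'/y)^{2s} − 1` for `0 < y ≤ y'` (from the two
comparisons and `0 ≤ u ≤ 1`). [cite: BeatonBousquetMelouDeGierDuminilCopinGuttmann2014, §3.1, Proposition 5 (arXiv v5 p. 9)]
[cite: MadrasSlade1993, §4.2 (4.2.4) (p. 90): `u ≤ 1`] -/
theorem abs_pwbAmp_sub_pwbAmp_le (hy : 0 < y) (h : y ≤ y') (s : ℕ) :
    |pwbAmp y' s - pwbAmp y s| ≤ (y' / y) ^ (2 * s) - 1 := by
  have hy' : 0 < y' := hy.trans_le h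
  have hr : 1 ≤ y' / y := (one_le_div hy).2 h
  have hu0 := pwbAmp_nonneg hy.le s
  have hu1 := pwbAmp_le_one hy s
  have hr2 : 1 ≤ (y' / y) ^ (2 * s) := one_le_pow₀ hr
  have hup := pwbAmp_le_div_pow_mul_pwbAmp hy h s
  have hlo := div_pow_mul_pwbAmp_le_pwbAmp hy h s
  rw [abs_le]
  constructor
  · have ha0 : 0 < (y' / y) ^ s := by positivity
    have hinv : (y / y') ^ s = ((y' / y) ^ s)⁻¹ := by rw [← inv_pow, inv_div]
    have h1 : 1 - (y / y') ^ s ≤ (y' / y) ^ s - 1 := by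
      rw [hinv, ← sub_nonneg]
      have h4 : (y' / y) ^ s - 1 - (1 - ((y' / y) ^ s)⁻¹) = ((y' / y) ^ s - 1) ^ 2 / (y' / y) ^ s := by
        field_simp
      rw [h4]
      positivity
    have h2 : (y' / y) ^ s ≤ (y' / y) ^ (2 * s) := pow_le_pow_right₀ hr (by omega)
    have h3 : 0 ≤ 1 - (y / y') ^ s := by
      rw [sub_nonneg]
      exact pow_le_one₀ (by positivity) ((div_le_one hy').2 h)
    have h5 : (1 - (y / y') ^ s) * pwbAmp y s ≤ 1 - (y / y') ^ s := by
      calc (1 - (y / y') ^ s) * pwbAmp y s ≤ (1 - (y / y') ^ s) * 1 := mul_le_mul_of_nonneg_left hu1 h3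
        _ = 1 - (y / y') ^ s := mul_one _
    nlinarith [h1, h2, h5, hlo]
  · have h5 : ((y' / y) ^ (2 * s) - 1) * pwbAmp y s ≤ (y' / y) ^ (2 * s) - 1 := by
      calc ((y' / y) ^ (2 * s) - 1) * pwbAmp y s ≤ ((y' / y) ^ (2 * s) - 1) * 1 :=
            mul_le_mul_of_nonneg_left hu1 (by linarith)
        _ = (y' / y) ^ (2 * s) - 1 := mul_one _
    nlinarith [hup, h5]

/-! ### B. The two-term modulus of continuity of `1/m(y)` and the log-Lipschitz corollary -/

/-- **Two-term modulus** (the rate as a hypothesis): if `|u_s(z) − 1/m(z)| ≤ K ρ^{-s}` for all `z ≥ y₀` and all `s`,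
then for `y₀ ≤ y ≤ y'` and EVERY `s`, `|1/m(y) − 1/m(y')| ≤ 2K ρ^{-s} + ((y'/y)^{2s} − 1)`.
[cite: Bednorz2013, §2, Corollary 2.5 (p. 5)] [cite: MadrasSlade1993, §4.2 Theorem 4.2.5 (p. 95)] -/
theorem abs_inv_pwbMean_sub_le_two_term {ρ K : ℝ}
    (hK : ∀ z : ℝ, y₀ ≤ z → ∀ s : ℕ, |pwbAmp z s - (pwbMean z)⁻¹| ≤ K * ρ⁻¹ ^ s)
    (hy₀ : 0 < y₀) (h₀ : y₀ ≤ y) (h : y ≤ y') (s : ℕ) :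
    |(pwbMean y)⁻¹ - (pwbMean y')⁻¹| ≤ 2 * K * ρ⁻¹ ^ s + ((y' / y) ^ (2 * s) - 1) := by
  have hy : 0 < y := hy₀.trans_le h₀
  have h1 := hK y h₀ s
  have h2 := hK y' (h₀.trans h) s
  have h3 := abs_pwbAmp_sub_pwbAmp_le hy h s
  calc |(pwbMean y)⁻¹ - (pwbMean y')⁻¹|
      = |-(pwbAmp y s - (pwbMean y)⁻¹) + -(pwbAmp y' s - pwbAmp y s) + (pwbAmp y' s - (pwbMean y')⁻¹)| := by
        congr 1
        ring
    _ ≤ |-(pwbAmp y s - (pwbMean y)⁻¹)| + |-(pwbAmp y' s - pwbAmp y s)| + |pwbAmp y' s - (pwbMean y')⁻¹| :=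
        abs_add_three _ _ _
    _ ≤ K * ρ⁻¹ ^ s + ((y' / y) ^ (2 * s) - 1) + K * ρ⁻¹ ^ s := by
        rw [abs_neg, abs_neg]
        exact add_le_add (add_le_add h1 h3) h2
    _ = 2 * K * ρ⁻¹ ^ s + ((y' / y) ^ (2 * s) - 1) := by ring

/-- **Two-term modulus of `1/m` on `[y₀, ∞)`, `y₀ > μ⁴`** (existential form, constants from car 51's uniform rate):
`∃ ρ > 1, ∃ K, ∀ y₀ ≤ y ≤ y', ∀ s, |1/m(y) − 1/m(y')| ≤ 2Kρ^{-s} + ((y'/y)^{2s} − 1)`.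
[cite: Bednorz2013, §2, Corollary 2.5 (p. 5)] [cite: MadrasSlade1993, §4.2 Theorem 4.2.5 (p. 95)] -/
theorem exists_two_term_modulus_inv_pwbMean (hy₀ : hexConnectiveConstant ^ 4 < y₀) :
    ∃ ρ : ℝ, 1 < ρ ∧ ∃ K : ℝ, ∀ y y' : ℝ, y₀ ≤ y → y ≤ y' → ∀ s : ℕ,
      |(pwbMean y)⁻¹ - (pwbMean y')⁻¹| ≤ 2 * K * ρ⁻¹ ^ s + ((y' / y) ^ (2 * s) - 1) := by
  obtain ⟨ρ, hρ, K, hK⟩ := exists_uniform_geometric_rate_pwbAmp hy₀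
  exact ⟨ρ, hρ, K, fun y y' h₀ h s =>
    abs_inv_pwbMean_sub_le_two_term hK (pos_of_mu_four_lt_km hy₀) h₀ h s⟩

/-- `(1 + ε)ⁿ ≤ 1/(1 − nε)` for `0 ≤ ε`, `nε < 1` (via `1 + ε ≤ e^ε` and `1 − x ≤ e^{−x}`). [cite: Feller1968, XIII.10 (elementary exponential bounds)] -/
private theorem one_add_pow_le_inv_one_sub {ε : ℝ} {n : ℕ} (hε : 0 ≤ ε) (hn : (n : ℝ) * ε < 1) :
    (1 + ε) ^ n ≤ 1 / (1 - n * ε) := by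
  have h1 : (1 + ε) ^ n ≤ Real.exp (n * ε) := by
    calc (1 + ε) ^ n ≤ Real.exp ε ^ n :=
          pow_le_pow_left₀ (by linarith) (by linarith [Real.add_one_le_exp ε]) n
      _ = Real.exp (n * ε) := by rw [← Real.exp_nat_mul]
  have h2 : Real.exp (n * ε) ≤ 1 / (1 - n * ε) := by
    rw [le_div_iff₀ (by linarith)]
    have h3 := Real.one_sub_le_exp_neg ((n : ℝ) * ε)
    have h4 : Real.exp (n * ε) * Real.exp (-(n * ε)) = 1 := by
      rw [← Real.exp_add, add_neg_cancel, Real.exp_zero]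
    calc Real.exp (n * ε) * (1 - n * ε) ≤ Real.exp (n * ε) * Real.exp (-(n * ε)) :=
          mul_le_mul_of_nonneg_left h3 (Real.exp_pos _).le
      _ = 1 := h4
  exact h1.trans h2

/-- `(1 + ε)ⁿ − 1 ≤ 2nε` for `0 ≤ ε`, `nε ≤ 1/2`. [cite: Feller1968, XIII.10 (elementary exponential bounds)] -/
private theorem one_add_pow_sub_one_le_two_mul {ε : ℝ} {n : ℕ} (hε : 0 ≤ ε) (hn : (n : ℝ) * ε ≤ 1 / 2) :
    (1 + ε) ^ n - 1 ≤ 2 * (n * ε) := by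
  have h := one_add_pow_le_inv_one_sub hε (by linarith)
  have hx : 1 / (1 - n * ε) ≤ 1 + 2 * (n * ε) := by
    rw [div_le_iff₀ (by linarith)]
    nlinarith [mul_nonneg (Nat.cast_nonneg n) hε]
  linarith

/-- **`1/m(y)` is locally LOG-LIPSCHITZ in the fugacity** (the rate as a hypothesis, `1 < ρ`): for `y₀ ≤ y ≤ y'` with
relative increment `ε = y'/y − 1 ∈ (0, 1]` satisfying `4ε (log(1/ε)/log ρ + 1) ≤ 1`,
`|1/m(y) − 1/m(y')| ≤ ε · (2K + 4 + 4 log(1/ε)/log ρ)` — take `s = ⌈log(1/ε)/log ρ⌉` in the two-term modulus, so that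
`ρ^{-s} ≤ ε` and `(1+ε)^{2s} − 1 ≤ 4sε ≤ 4ε(log(1/ε)/log ρ + 1)`.
[cite: Bednorz2013, §2, Corollary 2.5 (p. 5)] [cite: MadrasSlade1993, §4.2 Theorem 4.2.5 (p. 95)] -/
theorem abs_inv_pwbMean_sub_le_logLipschitz {ρ K ε : ℝ} (hρ : 1 < ρ)
    (hK : ∀ z : ℝ, y₀ ≤ z → ∀ s : ℕ, |pwbAmp z s - (pwbMean z)⁻¹| ≤ K * ρ⁻¹ ^ s)
    (hy₀ : 0 < y₀) (h₀ : y₀ ≤ y) (h : y ≤ y') (hε : ε = y' / y - 1) (hε0 : 0 < ε) (hε1 : ε ≤ 1)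
    (hside : 4 * ε * (Real.log ε⁻¹ / Real.log ρ + 1) ≤ 1) :
    |(pwbMean y)⁻¹ - (pwbMean y')⁻¹| ≤ ε * (2 * K + 4 + 4 * (Real.log ε⁻¹ / Real.log ρ)) := by
  have hy : 0 < y := hy₀.trans_le h₀
  have hρ0 : 0 < ρ := by linarith
  have hlogρ : 0 < Real.log ρ := Real.log_pos hρ
  have hK0 : 0 ≤ K := by
    have h1 := (abs_nonneg _).trans (hK y h₀ 0)
    simpa using h1
  set x := Real.log ε⁻¹ / Real.log ρ with hx
  have hlogε : 0 ≤ Real.log ε⁻¹ := Real.log_nonneg ((one_le_inv₀ hε0).2 hε1)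
  have hx0 : 0 ≤ x := div_nonneg hlogε hlogρ.le
  set s := ⌈x⌉₊ with hs
  have hxs : x ≤ s := Nat.le_ceil x
  have hs1 : (s : ℝ) < x + 1 := Nat.ceil_lt_add_one hx0
  -- ρ ^ x = 1/ε, hence ρ⁻¹ ^ s ≤ ε
  have hρx : ρ ^ x = ε⁻¹ := by
    rw [Real.rpow_def_of_pos hρ0]
    have h1 : Real.log ρ * x = Real.log ε⁻¹ := by rw [hx]; field_simp
    rw [h1, Real.exp_log (inv_pos.2 hε0)]
  have hρs : ρ⁻¹ ^ s ≤ ε := by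
    have h1 : ε⁻¹ ≤ ρ ^ s := by
      rw [← hρx, ← Real.rpow_natCast]
      exact Real.rpow_le_rpow_of_exponent_le hρ.le hxs
    rw [inv_pow]
    exact inv_le_of_inv_le₀ hε0 h1
  -- the second term
  have hsε : (s : ℝ) * ε < (x + 1) * ε := mul_lt_mul_of_pos_right hs1 hε0
  have h2s : ((2 * s : ℕ) : ℝ) * ε ≤ 1 / 2 := by
    push_cast
    nlinarith [hsε, hside, hx0, hε0]
  have hterm2 : (y' / y) ^ (2 * s) - 1 ≤ 4 * ε * (x + 1) := by
    have h1 : y' / y = 1 + ε := by rw [hε]; ring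
    rw [h1]
    have h2 := one_add_pow_sub_one_le_two_mul hε0.le h2s
    push_cast at h2
    nlinarith [h2, hsε, hε0]
  have hmain := abs_inv_pwbMean_sub_le_two_term hK hy₀ h₀ h s
  have hterm1 : 2 * K * ρ⁻¹ ^ s ≤ 2 * K * ε := mul_le_mul_of_nonneg_left hρs (by linarith)
  calc |(pwbMean y)⁻¹ - (pwbMean y')⁻¹| ≤ 2 * K * ρ⁻¹ ^ s + ((y' / y) ^ (2 * s) - 1) := hmain
    _ ≤ 2 * K * ε + 4 * ε * (x + 1) := add_le_add hterm1 hterm2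
    _ = ε * (2 * K + 4 + 4 * x) := by ring

/-- **Log-Lipschitz modulus of `1/m` on `[y₀, ∞)`, `y₀ > μ⁴`** (existential form): there are `ρ > 1` and `K` (car 51's)
such that for all `y₀ ≤ y ≤ y'` whose relative increment `ε = y'/y − 1 ∈ (0, 1]` satisfies
`4ε(log(1/ε)/log ρ + 1) ≤ 1`: `|1/m(y) − 1/m(y')| ≤ ε (2K + 4 + 4 log(1/ε)/log ρ)`.
[cite: Bednorz2013, §2, Corollary 2.5 (p. 5)] [cite: MadrasSlade1993, §4.2 Theorem 4.2.5 (p. 95)] -/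
theorem exists_logLipschitz_inv_pwbMean (hy₀ : hexConnectiveConstant ^ 4 < y₀) :
    ∃ ρ : ℝ, 1 < ρ ∧ ∃ K : ℝ, ∀ y y' : ℝ, y₀ ≤ y → y ≤ y' → 0 < y' / y - 1 → y' / y - 1 ≤ 1 →
      4 * (y' / y - 1) * (Real.log (y' / y - 1)⁻¹ / Real.log ρ + 1) ≤ 1 →
      |(pwbMean y)⁻¹ - (pwbMean y')⁻¹| ≤
        (y' / y - 1) * (2 * K + 4 + 4 * (Real.log (y' / y - 1)⁻¹ / Real.log ρ)) := by
  obtain ⟨ρ, hρ, K, hK⟩ := exists_uniform_geometric_rate_pwbAmp hy₀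
  exact ⟨ρ, hρ, K, fun y y' h₀ h hε0 hε1 hside =>
    abs_inv_pwbMean_sub_le_logLipschitz hρ hK (pos_of_mu_four_lt_km hy₀) h₀ h rfl hε0 hε1 hside⟩

/-- The side condition of the log-Lipschitz bound holds for ALL small increments: if `0 < ε ≤ min(1/8, (log ρ/16)²)`
then `4ε (log(1/ε)/log ρ + 1) ≤ 1` (from `log x ≤ 2√x`). [cite: Feller1968, XIII.10 (elementary exponential bounds)] -/
private theorem logLipschitz_side_of_le {ρ ε : ℝ} (hρ : 1 < ρ) (hε0 : 0 < ε)
    (hε : ε ≤ min (1 / 8) ((Real.log ρ / 16) ^ 2)) :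
    4 * ε * (Real.log ε⁻¹ / Real.log ρ + 1) ≤ 1 := by
  have hlogρ : 0 < Real.log ρ := Real.log_pos hρ
  have hε8 : ε ≤ 1 / 8 := hε.trans (min_le_left _ _)
  have hεσ : ε ≤ (Real.log ρ / 16) ^ 2 := hε.trans (min_le_right _ _)
  have hsq : Real.sqrt ε ≤ Real.log ρ / 16 := by
    calc Real.sqrt ε ≤ Real.sqrt ((Real.log ρ / 16) ^ 2) := Real.sqrt_le_sqrt hεσ
      _ = Real.log ρ / 16 := Real.sqrt_sq (by positivity)
  have hsε : 0 < Real.sqrt ε := Real.sqrt_pos.2 hε0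
  have hlog : Real.log ε⁻¹ ≤ 2 / Real.sqrt ε := by
    have h1 := Real.log_le_rpow_div (inv_nonneg.2 hε0.le) (show (0:ℝ) < 1 / 2 by norm_num)
    have h2 : (ε⁻¹) ^ ((1:ℝ) / 2) = 1 / Real.sqrt ε := by
      rw [Real.inv_rpow hε0.le, Real.sqrt_eq_rpow, one_div (ε ^ ((1:ℝ) / 2))]
    rw [h2] at h1
    calc Real.log ε⁻¹ ≤ 1 / Real.sqrt ε / (1 / 2) := h1
      _ = 2 / Real.sqrt ε := by field_simp
  have h4 : 4 * ε * (2 / Real.sqrt ε) = 8 * Real.sqrt ε := by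
    rw [mul_div_assoc', div_eq_iff hsε.ne', mul_assoc 8, Real.mul_self_sqrt hε0.le]
    ring
  have h3 : 4 * ε * (Real.log ε⁻¹ / Real.log ρ) ≤ 1 / 2 := by
    calc 4 * ε * (Real.log ε⁻¹ / Real.log ρ) = 4 * ε * Real.log ε⁻¹ / Real.log ρ := by ring
      _ ≤ 4 * ε * (2 / Real.sqrt ε) / Real.log ρ :=
          div_le_div_of_nonneg_right (mul_le_mul_of_nonneg_left hlog (by linarith)) hlogρ.le
      _ = 8 * Real.sqrt ε / Real.log ρ := by rw [h4]
      _ ≤ 8 * (Real.log ρ / 16) / Real.log ρ := div_le_div_of_nonneg_right (by linarith) hlogρ.le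
      _ = 1 / 2 := by field_simp; ring
  calc 4 * ε * (Real.log ε⁻¹ / Real.log ρ + 1) = 4 * ε * (Real.log ε⁻¹ / Real.log ρ) + 4 * ε := by ring
    _ ≤ 1 / 2 + 1 / 2 := add_le_add h3 (by linarith)
    _ = 1 := by norm_num

/-- **Log-Lipschitz modulus with an explicit neighbourhood**: `∃ ρ > 1, ∃ K, ∃ ε₀ > 0` (namely
`ε₀ = min(1/8, (log ρ/16)²)`) such that for all `y₀ ≤ y < y' ≤ (1 + ε₀) y`:
`|1/m(y) − 1/m(y')| ≤ ε (2K + 4 + 4 log(1/ε)/log ρ)`, `ε = y'/y − 1`. [cite: Bednorz2013, §2, Corollary 2.5 (p. 5)]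
[cite: MadrasSlade1993, §4.2 Theorem 4.2.5 (p. 95)] -/
theorem exists_logLipschitz_modulus_inv_pwbMean (hy₀ : hexConnectiveConstant ^ 4 < y₀) :
    ∃ ρ : ℝ, 1 < ρ ∧ ∃ K ε₀ : ℝ, 0 < ε₀ ∧ ∀ y y' : ℝ, y₀ ≤ y → y < y' → y' ≤ (1 + ε₀) * y →
      |(pwbMean y)⁻¹ - (pwbMean y')⁻¹| ≤
        (y' / y - 1) * (2 * K + 4 + 4 * (Real.log (y' / y - 1)⁻¹ / Real.log ρ)) := by
  obtain ⟨ρ, hρ, K, hK⟩ := exists_uniform_geometric_rate_pwbAmp hy₀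
  have hlogρ : 0 < Real.log ρ := Real.log_pos hρ
  refine ⟨ρ, hρ, K, min (1 / 8) ((Real.log ρ / 16) ^ 2), lt_min (by norm_num) (by positivity),
    fun y y' h₀ hlt hle => ?_⟩
  have hy : 0 < y := (pos_of_mu_four_lt_km hy₀).trans_le h₀
  have hε0 : 0 < y' / y - 1 := by
    rw [sub_pos, lt_div_iff₀ hy, one_mul]
    exact hlt
  have hεle : y' / y - 1 ≤ min (1 / 8) ((Real.log ρ / 16) ^ 2) := by
    rw [sub_le_iff_le_add, div_le_iff₀ hy]
    linarith
  have hε1 : y' / y - 1 ≤ 1 := hεle.trans ((min_le_left _ _).trans (by norm_num))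
  exact abs_inv_pwbMean_sub_le_logLipschitz hρ hK (pos_of_mu_four_lt_km hy₀) h₀ hlt.le rfl hε0 hε1
    (logLipschitz_side_of_le hρ hε0 hεle)

/-! ### C. The ratio test `PWB_{2s+2}/PWB_{2s} → β²` with an explicit geometric rate, uniformly in `y` -/

/-- `u_1(y)^s ≤ u_s(y)` (supermultiplicativity `PWB_2^s ≤ PWB_{2s}`). [cite: MadrasSlade1993, §1.2 (1.2.17)–(1.2.19) (p. 12): concatenation of bridges] -/
theorem pwbAmp_one_pow_le (hy : 0 < y) (s : ℕ) : pwbAmp y 1 ^ s ≤ pwbAmp y s := by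
  have h := PWB_pow_le hy.le 1 s
  simp only [mul_one] at h
  have hβ := wallRate_pos y
  unfold pwbAmp
  rw [mul_one, div_pow, ← pow_mul]
  exact div_le_div_of_nonneg_right h (pow_pos hβ _).le

/-- A lower bound for every amplitude, UNIFORM on `[y₀, ∞)`: `(y₀/β(y₀)²)^s ≤ u_s(y)` for `0 < y₀ ≤ y`
(`y₀/β(y₀)² ≤ f_1(y) ≤ u_1(y)`, then `u_1^s ≤ u_s`). [cite: MadrasSlade1993, §1.2 (1.2.17) (p. 12); §4.2 (4.2.4) (p. 90)]
[cite: BeatonBousquetMelouDeGierDuminilCopinGuttmann2014, §3.1, Proposition 5 (arXiv v5 p. 9)] -/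
theorem div_sq_wallRate_pow_le_pwbAmp (hy₀ : 0 < y₀) (h : y₀ ≤ y) (s : ℕ) :
    (y₀ / wallRate y₀ ^ 2) ^ s ≤ pwbAmp y s := by
  have hy : 0 < y := hy₀.trans_le h
  have h1 : y₀ / wallRate y₀ ^ 2 ≤ pwbAmp y 1 :=
    (div_sq_wallRate_le_pwbLaw_one_of_le hy₀ h).trans (pwbLaw_le_pwbAmp hy.le 1)
  exact (pow_le_pow_left₀ (div_nonneg hy₀.le (sq_nonneg _)) h1 s).trans (pwbAmp_one_pow_le hy s)

/-- The mean renewal time bounded UNIFORMLY on `[y₀, ∞)`: `m(y) ≤ 1 + μ⁴ θ₀/(1 − θ₀)²`, `θ₀ = μ²/√y₀`, for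
`μ⁴ < y₀ ≤ y` (the tree's `pwbMean_le` with `θ(y) ≤ θ₀`). [cite: Feller1968, XIII.3] [cite: MadrasSlade1993, §4.2, remark before (4.2.21) (p. 94)] -/
theorem pwbMean_le_of_le (hy₀ : hexConnectiveConstant ^ 4 < y₀) (h : y₀ ≤ y) :
    pwbMean y ≤ 1 + hexConnectiveConstant ^ 4 *
      ((hexConnectiveConstant ^ 2 / Real.sqrt y₀) / (1 - hexConnectiveConstant ^ 2 / Real.sqrt y₀) ^ 2) := by
  have hy : hexConnectiveConstant ^ 4 < y := hy₀.trans_le h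
  have hy₀0 := pos_of_mu_four_lt_km hy₀
  obtain ⟨hθ₀0, hθ₀1⟩ := theta_pos_lt_one_km hy₀
  obtain ⟨hθ0, hθ1⟩ := theta_pos_lt_one_km hy
  have hθθ₀ : hexConnectiveConstant ^ 2 / Real.sqrt y ≤ hexConnectiveConstant ^ 2 / Real.sqrt y₀ :=
    div_le_div_of_nonneg_left (pow_nonneg hexConnectiveConstant_pos.le 2) (Real.sqrt_pos.2 hy₀0)
      (Real.sqrt_le_sqrt h)
  have h1 := pwbMean_le hy
  have h2 : (hexConnectiveConstant ^ 2 / Real.sqrt y) / (1 - hexConnectiveConstant ^ 2 / Real.sqrt y) ^ 2 ≤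
      (hexConnectiveConstant ^ 2 / Real.sqrt y₀) / (1 - hexConnectiveConstant ^ 2 / Real.sqrt y₀) ^ 2 :=
    div_le_div₀ hθ₀0.le hθθ₀ (by nlinarith) (pow_le_pow_left₀ (by linarith) (by linarith) 2)
  nlinarith [h1, h2, pow_nonneg hexConnectiveConstant_pos.le 4]

/-- **The ratio test for the adsorbed wall-bridge rate with an explicit geometric rate, UNIFORMLY in `y` on `[y₀, ∞)`,
`y₀ > μ⁴`**: `∃ ρ > 1, ∃ K, ∀ y ≥ y₀, ∀ s, |PWB_{2s+2}(y)/PWB_{2s}(y) − β(y)²| ≤ K β(y)² ρ^{-s}` — the quantitative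
form of the tree's `tendsto_PWB_ratio`. With `(ρ, K)` from car 51, `M₀` the uniform mean bound and `b₀ = y₀/β(y₀)²`:
for `s ≥ s₀` (`Kρ^{-s₀} < 1/(2M₀)`) one has `u_s ≥ 1/(2M₀)` and the relative error is `≤ 4M₀Kρ^{-s}`; for `s < s₀`
it is `≤ 1/u_s ≤ b₀^{-s} ≤ (ρ/b₀)^{s₀} ρ^{-s}`. [cite: MadrasSlade1993, §1.2 (1.2.4)–(1.2.10) (pp. 9–10); §4.2 Theorem 4.2.5 (p. 95)]
[cite: Bednorz2013, §2, Corollary 2.5 (p. 5)] -/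
theorem exists_uniform_geometric_rate_PWB_ratio (hy₀ : hexConnectiveConstant ^ 4 < y₀) :
    ∃ ρ : ℝ, 1 < ρ ∧ ∃ K : ℝ, ∀ y : ℝ, y₀ ≤ y → ∀ s : ℕ,
      |PWB (2 * s + 2) y / PWB (2 * s) y - wallRate y ^ 2| ≤ K * wallRate y ^ 2 * ρ⁻¹ ^ s := by
  obtain ⟨ρ, hρ, K, hK⟩ := exists_uniform_geometric_rate_pwbAmp hy₀
  have hy₀0 := pos_of_mu_four_lt_km hy₀
  obtain ⟨hθ0, hθ1⟩ := theta_pos_lt_one_km hy₀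
  set θ := hexConnectiveConstant ^ 2 / Real.sqrt y₀ with hθ
  set M := 1 + hexConnectiveConstant ^ 4 * (θ / (1 - θ) ^ 2) with hM
  have hM1 : 1 ≤ M := by
    have : 0 ≤ hexConnectiveConstant ^ 4 * (θ / (1 - θ) ^ 2) :=
      mul_nonneg (pow_nonneg hexConnectiveConstant_pos.le 4) (div_nonneg hθ0.le (sq_nonneg _))
    linarith
  have hM0 : 0 < M := by linarith
  set b := y₀ / wallRate y₀ ^ 2 with hb
  have hb0 : 0 < b := div_pos hy₀0 (pow_pos (wallRate_pos y₀) 2)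
  have hb1 : b ≤ 1 := by
    have h1 : b ^ 1 ≤ pwbAmp y₀ 1 := div_sq_wallRate_pow_le_pwbAmp hy₀0 le_rfl 1
    rw [pow_one] at h1
    exact h1.trans (pwbAmp_le_one hy₀0 1)
  have hK0 : 0 ≤ K := by
    have h1 := (abs_nonneg _).trans (hK y₀ le_rfl 0)
    simpa using h1
  have hρ0 : 0 < ρ := by linarith
  have hρi0 : 0 ≤ ρ⁻¹ := inv_nonneg.2 hρ0.le
  have hρi1 : ρ⁻¹ ≤ 1 := inv_le_one_of_one_le₀ hρ.le
  -- s₀ with K ρ⁻¹^s < 1/(2M) for s ≥ s₀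
  have hlim : Tendsto (fun s : ℕ => K * ρ⁻¹ ^ s) atTop (𝓝 0) := by
    simpa using (tendsto_pow_atTop_nhds_zero_of_lt_one hρi0 (inv_lt_one_of_one_lt₀ hρ)).const_mul K
  obtain ⟨s₀, hs₀⟩ := eventually_atTop.1 ((tendsto_order.1 hlim).2 (1 / (2 * M)) (by positivity))
  refine ⟨ρ, hρ, max (4 * M * K) ((ρ / b) ^ s₀), fun y hy s => ?_⟩
  have hyμ : hexConnectiveConstant ^ 4 < y := hy₀.trans_le hy
  have hy0 : 0 < y := hy₀0.trans_le hy
  have hβ := wallRate_pos y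
  have hP : ∀ j, 0 < PWB (2 * j) y := PWB_pos hy0
  have hu0 : ∀ j, 0 < pwbAmp y j := fun j => div_pos (hP j) (pow_pos hβ _)
  -- the ratio in terms of amplitudes
  have hratio : PWB (2 * s + 2) y / PWB (2 * s) y - wallRate y ^ 2 =
      wallRate y ^ 2 * ((pwbAmp y (s + 1) - pwbAmp y s) / pwbAmp y s) := by
    have hPs : PWB (2 * s) y ≠ 0 := (hP s).ne'
    have hβne : wallRate y ≠ 0 := hβ.ne'
    rw [pwbAmp, pwbAmp, show 2 * (s + 1) = 2 * s + 2 by ring]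
    field_simp
    ring
  rw [hratio, abs_mul, abs_of_pos (pow_pos hβ 2), mul_comm (max _ _) (wallRate y ^ 2), mul_assoc]
  refine mul_le_mul_of_nonneg_left ?_ (pow_pos hβ 2).le
  rw [abs_div, abs_of_pos (hu0 s)]
  rcases le_or_gt s₀ s with hs | hs
  · -- large s: u_s ≥ 1/(2M)
    have hKs : K * ρ⁻¹ ^ s < 1 / (2 * M) := hs₀ s hs
    have hL : 1 / M ≤ (pwbMean y)⁻¹ := by
      rw [one_div]
      exact inv_anti₀ (pwbMean_pos hyμ) (by rw [hM, hθ]; exact pwbMean_le_of_le hy₀ hy)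
    have hus : 1 / (2 * M) ≤ pwbAmp y s := by
      have h1 := hK y hy s
      rw [abs_le] at h1
      have h2 : 1 / (2 * M) = 1 / M - 1 / (2 * M) := by field_simp; ring
      linarith [h1.1]
    have hnum : |pwbAmp y (s + 1) - pwbAmp y s| ≤ 2 * (K * ρ⁻¹ ^ s) := by
      have h1 := hK y hy s
      have h2 := hK y hy (s + 1)
      have h3 : K * ρ⁻¹ ^ (s + 1) ≤ K * ρ⁻¹ ^ s := by
        rw [pow_succ]
        exact mul_le_mul_of_nonneg_left (mul_le_of_le_one_right (pow_nonneg hρi0 s) hρi1) hK0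
      calc |pwbAmp y (s + 1) - pwbAmp y s|
          = |(pwbAmp y (s + 1) - (pwbMean y)⁻¹) + -(pwbAmp y s - (pwbMean y)⁻¹)| := by congr 1; ring
        _ ≤ |pwbAmp y (s + 1) - (pwbMean y)⁻¹| + |-(pwbAmp y s - (pwbMean y)⁻¹)| := abs_add_le _ _
        _ ≤ K * ρ⁻¹ ^ s + K * ρ⁻¹ ^ s := by rw [abs_neg]; exact add_le_add (h2.trans h3) h1
        _ = 2 * (K * ρ⁻¹ ^ s) := by ring
    calc |pwbAmp y (s + 1) - pwbAmp y s| / pwbAmp y s ≤ 2 * (K * ρ⁻¹ ^ s) / (1 / (2 * M)) :=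
          div_le_div₀ (by positivity) hnum (by positivity) hus
      _ = 4 * M * K * ρ⁻¹ ^ s := by field_simp; ring
      _ ≤ max (4 * M * K) ((ρ / b) ^ s₀) * ρ⁻¹ ^ s :=
          mul_le_mul_of_nonneg_right (le_max_left _ _) (pow_nonneg hρi0 s)
  · -- small s: 1/u_s ≤ b^{-s} ≤ (ρ/b)^{s₀} ρ^{-s}
    have hnum : |pwbAmp y (s + 1) - pwbAmp y s| ≤ 1 := by
      rw [abs_le]
      constructor <;> linarith [(hu0 (s + 1)).le, pwbAmp_le_one hy0 (s + 1), (hu0 s).le, pwbAmp_le_one hy0 s]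
    have hus : b ^ s ≤ pwbAmp y s := div_sq_wallRate_pow_le_pwbAmp hy₀0 hy s
    have h1 : |pwbAmp y (s + 1) - pwbAmp y s| / pwbAmp y s ≤ 1 / b ^ s :=
      div_le_div₀ zero_le_one hnum (pow_pos hb0 s) hus
    have h2 : (ρ / b) ^ s * ρ⁻¹ ^ s = 1 / b ^ s := by
      rw [← mul_pow, div_mul_eq_mul_div, mul_inv_cancel₀ hρ0.ne', div_pow, one_pow]
    have h3 : (ρ / b) ^ s ≤ (ρ / b) ^ s₀ :=
      pow_le_pow_right₀ ((one_le_div hb0).2 (hb1.trans hρ.le)) hs.le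
    calc |pwbAmp y (s + 1) - pwbAmp y s| / pwbAmp y s ≤ 1 / b ^ s := h1
      _ = (ρ / b) ^ s * ρ⁻¹ ^ s := h2.symm
      _ ≤ (ρ / b) ^ s₀ * ρ⁻¹ ^ s := mul_le_mul_of_nonneg_right h3 (pow_nonneg hρi0 s)
      _ ≤ max (4 * M * K) ((ρ / b) ^ s₀) * ρ⁻¹ ^ s :=
          mul_le_mul_of_nonneg_right (le_max_right _ _) (pow_nonneg hρi0 s)

end Literature.Probability.RandomPlanarGeometry.SAW.HexBW.Wall

end
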